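import Summits.NavierStokesRegularity.FunctionalMining.StrainMomentBalance
import Summits.NavierStokesRegularity.FunctionalMining.StrainMomentProduction
import Summits.NavierStokesRegularity.FunctionalMining.VorticityMomentSaturatingLaw
import Summits.NavierStokesRegularity.FunctionalMining.SaturatingLawLyapunov
import HarnessLib

/-!
# FunctionalMining — K0 rows `ES.absS.q|T_LD|G1` for every real `q > 2` (kernel), and `EK.ES.absS.q|T_M0`

Search for candidate a priori estimates; no regularity claim. Cell `pub-nsfunc`, prove seat
(gen 10). The strain twin of `VorticityMomentSaturatingLaw` (SIEVELD §3.2/§3.3): for every real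
`q > 2` there is `κ` with

`d/dt ∫|S|^q ≤ κ · ν^{−(3q−3)/(2q−3)} · (2ℰ) · (∫|S|^q)^{1+1/(2q−3)}`

along every zero-mean classical solution of unforced Navier–Stokes on `T³` — the cell's saturating
law `T_LD` (`Candidates.SaturatingLaw`) for `torusStrainMoment q` with `σ = 2q − 3`,
`γ = (3q−3)/(2q−3)`. Assembly of

* the slice form of the exact balance (`GradientTensor.derivWithin_Bq_le`, file
  `StrainMomentBalance`: `C¹` weight `s^{q/2}`, viscous sign at a real exponent):
  `Ḃ_q ≤ −qνI − qX_P − qX_N`, `I = ∫|S|^{q−2}∑ₖ∑ᵢⱼ(∂ₖSᵢⱼ)²`;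
* the static bounds `|X_N|, |X_P| ≤ C I^a (ℰ B_q^{1+1/σ})^{1−a}`, `a = (3q−3)/(5q−6)`
  (`StrainMomentProduction`: Hölder, strain and pressure-Hessian Calderón–Zygmund at the real
  exponent, Cauchy–Schwarz interpolation, the codomain-generic top node on the flattened strain,
  and the exponent bookkeeping of §3.2);
* Young at the weights `(a, 1−a)` (`VorticityMoment.young_rpow`): `a/(1−a) = γ`.

Rows filed literally: `ES.absS.q=3|T_LD|G1` (`σ = 3`, `γ = 2`), and the Lyapunov rows
`EK.ES.absS.q|T_M0` (`SaturatingLaw.antitoneOn_lyapunov`), literally `EK.ES.absS.q=3|T_M0`.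
Row `ES.absS.q=4` is `StrainL4.strainL4_saturatingLaw` (Cauchy–Schwarz-only chain) and is also the
case `q = 4` here. Existential constants; a priori inequalities along smooth solutions, small-data
closing only.
-/

noncomputable section

open MeasureTheory Finset Set Filter Topology
open scoped InnerProductSpace RealInnerProductSpace ContDiff

namespace Summit.NavierStokesRegularity.FunctionalMining

open Literature.Analysis.FunctionSpaces Literature.Analysis.FunctionSpaces.Torus
  Literature.Analysis.FluidPDE

namespace StrainMoment

open StrainL4

/-! ## 1. The matrix functionals in terms of `φ = ‖strainFlat v‖` -/

/-- `(|S|²)^{q/2} = φ^q`. [ours] -/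
theorem strainSqAt_rpow_half (v : UnitAddTorus (Fin 3) → EuclideanSpace ℝ (Fin 3))
    (x : UnitAddTorus (Fin 3)) (q : ℝ) :
    torusStrainSqAt v x ^ (q / 2) = ‖strainFlat v x‖ ^ q := by
  rw [strainSqAt_rpow_eq]; congr 1; ring

/-- `(|S|²)^{q/2−1} = φ^{q−2}`. [ours] -/
theorem strainSqAt_rpow_half_sub_one (v : UnitAddTorus (Fin 3) → EuclideanSpace ℝ (Fin 3))
    (x : UnitAddTorus (Fin 3)) (q : ℝ) :
    torusStrainSqAt v x ^ (q / 2 - 1) = ‖strainFlat v x‖ ^ (q - 2) := by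
  rw [strainSqAt_rpow_eq]; congr 1; ring

/-- `∫|S|^q = ∫ φ^q` (`torusStrainMoment q v = ∫ ‖strainFlat v‖^q`). [ours] -/
theorem torusStrainMoment_eq_integral_norm (q : ℝ)
    (v : UnitAddTorus (Fin 3) → EuclideanSpace ℝ (Fin 3)) :
    torusStrainMoment q v = ∫ x, ‖strainFlat v x‖ ^ q := by
  show (∫ x, torusStrainSqAt v x ^ (q / 2)) = _
  exact integral_congr_ae (ae_of_all _ fun x => strainSqAt_rpow_half v x q)

/-- `ℰ = ∫ φ²` for smooth divergence-free fields (`∫|S|² = ℰ`, tree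
`integral_strainNormSq_eq_torusEnstrophy`). [folklore] -/
theorem torusEnstrophy_eq_integral_norm_sq {v : UnitAddTorus (Fin 3) → EuclideanSpace ℝ (Fin 3)}
    (hv : IsSmooth v) (hdiv : IsDivFree v) :
    torusEnstrophy v = ∫ x, ‖strainFlat v x‖ ^ (2 : ℝ) := by
  rw [← integral_strainNormSq_eq_torusEnstrophy hv hdiv]
  exact integral_congr_ae (ae_of_all _ fun x => by
    show torusStrainSqAt v x = ‖strainFlat v x‖ ^ (2 : ℝ)
    rw [Real.rpow_two, norm_strainFlat_sq])

/-! ## 2. The saturating law for real `q > 2` -/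

/-- **K0 rows `ES.absS.q|T_LD|G1` HOLD (∃κ) for every real `q > 2`, in the kernel, on
`T³ = UnitAddTorus (Fin 3)`.** There is a constant `κ` such that along every zero-mean classical
solution of the unforced Navier–Stokes equations on `T³` (`ν > 0`), at every time of the window,
`s ↦ ∫|S(u(s))|^q` is differentiable within the window and
`d/dt ∫|S|^q ≤ κ · ν^{−(3q−3)/(2q−3)} · (2ℰ) · (∫|S|^q)^{1+1/(2q−3)}` — the cell's saturating law
`T_LD` with `σ = 2q − 3`, `γ = (3q−3)/(2q−3)` (`Candidates.SaturatingLaw`, `torusStrainMoment q`).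
Existential constant (codomain-generic mean-zero Sobolev constant, strain Calderón–Zygmund constant at
`s = 2q`, pressure-Hessian Calderón–Zygmund constant at `q`); an a priori inequality, small-data
closing only. [ours; strain twin of SIEVELD §3.2 with tree inputs] -/
theorem strainMoment_saturatingLaw {q : ℝ} (hq : 2 < q) :
    ∃ κ : ℝ, SaturatingLaw (d := Fin 3) (torusStrainMoment q) (2 * q - 3)
      ((3 * q - 3) / (2 * q - 3)) κ := by
  obtain ⟨CT, hCT0, hCT⟩ := exists_top_rpow hq
  obtain ⟨K, hK0, hK⟩ := exists_cz_rpow (q := q) (by linarith)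
  obtain ⟨CP, hCP0, hCP⟩ := exists_hess_rpow (d := Fin 3) (q := q) (by linarith)
  -- the exponent `e = a = γ/(1+γ)` and the static constants
  obtain ⟨e, he⟩ : ∃ e : ℝ, e = (3 * q - 3) / (5 * q - 6) := ⟨_, rfl⟩
  obtain ⟨CN, hCN⟩ : ∃ C : ℝ, C = Real.sqrt 2 * K ^ (1 / q) * CT ^ (e / 3) := ⟨_, rfl⟩
  obtain ⟨CQ, hCQ⟩ : ∃ C : ℝ,
      C = Real.sqrt 2 * ((9 : ℝ) ^ q * CP * K) ^ (1 / q) * CT ^ (e / 3) := ⟨_, rfl⟩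
  have h56 : 0 < 5 * q - 6 := by linarith
  have h23 : 0 < 2 * q - 3 := by linarith
  have he0 : 0 < e := by rw [he]; exact div_pos (by linarith) h56
  have he1 : e < 1 := by rw [he, div_lt_one h56]; linarith
  have h1e : 1 - e = (2 * q - 3) / (5 * q - 6) := by
    rw [he, one_sub_div h56.ne']; congr 1; ring
  have hγ : e / (1 - e) = (3 * q - 3) / (2 * q - 3) := by
    rw [h1e, he, div_div_div_cancel_right₀ h56.ne']
  have h9 : 0 ≤ (9 : ℝ) ^ q * CP * K := by positivity
  have hCN0 : 0 ≤ CN := by rw [hCN]; positivity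
  have hCQ0 : 0 ≤ CQ := by rw [hCQ]; positivity
  have hC0 : 0 ≤ CN + CQ := add_nonneg hCN0 hCQ0
  refine ⟨q / 2 * (CN + CQ) ^ (1 / (1 - e)), ?_⟩
  intro _ ν hν a b hab u p hsol hmean t ht
  have hut : IsSmooth (u t) := hsol.smooth_velocity.isSmooth_slice ht
  have hdiv : IsDivFree (u t) := hsol.divFree t ht
  have hF : (fun s => torusStrainMoment q (u s)) =
      fun s => ∫ x, torusStrainSqAt (u s) x ^ (q / 2) := rfl
  obtain ⟨hdiff, hle⟩ := GradientTensor.derivWithin_Bq_le hab hν.le hsol hq ht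
  refine ⟨by rw [hF]; exact hdiff, ?_⟩
  rw [hF]
  show _ ≤ q / 2 * (CN + CQ) ^ (1 / (1 - e)) * ν ^ (-((3 * q - 3) / (2 * q - 3))) *
      (2 * torusEnstrophy (u t)) * (torusStrainMoment q (u t)) ^ (1 + (2 * q - 3)⁻¹)
  -- opaque names for the slice quantities
  obtain ⟨XN, hXN⟩ : ∃ X : ℝ, X = ∫ x, torusStrainSqAt (u t) x ^ (q / 2 - 1) * ∑ i, ∑ j,
      (partialDeriv j (u t) x i + partialDeriv i (u t) x j) / 2 *
        ∑ k, partialDeriv i (u t) x k * partialDeriv k (u t) x j := ⟨_, rfl⟩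
  obtain ⟨XP, hXP⟩ : ∃ X : ℝ, X = ∫ x, torusStrainSqAt (u t) x ^ (q / 2 - 1) * ∑ i, ∑ j,
      (partialDeriv j (u t) x i + partialDeriv i (u t) x j) / 2 *
        partialDeriv i (partialDeriv j (p t)) x := ⟨_, rfl⟩
  obtain ⟨I', hI'⟩ : ∃ I : ℝ, I = ∫ x, torusStrainSqAt (u t) x ^ (q / 2 - 1) * ∑ k, ∑ i, ∑ j,
      ((partialDeriv k (partialDeriv j (u t)) x i +
        partialDeriv k (partialDeriv i (u t)) x j) / 2) ^ 2 := ⟨_, rfl⟩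
  obtain ⟨I, hI⟩ : ∃ I : ℝ, I = ∫ x, ‖strainFlat (u t) x‖ ^ (q - 2) * ∑ k, ∑ i, ∑ j,
      ((partialDeriv k (partialDeriv j (u t)) x i +
        partialDeriv k (partialDeriv i (u t)) x j) / 2) ^ 2 := ⟨_, rfl⟩
  obtain ⟨Z, hZ⟩ : ∃ Z : ℝ, Z = ∫ x, ‖strainFlat (u t) x‖ ^ (2 : ℝ) := ⟨_, rfl⟩
  obtain ⟨F, hFq⟩ : ∃ F : ℝ, F = ∫ x, ‖strainFlat (u t) x‖ ^ q := ⟨_, rfl⟩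
  obtain ⟨M, hM⟩ : ∃ M : ℝ, M = Z * F ^ (1 + (2 * q - 3)⁻¹) := ⟨_, rfl⟩
  have hII : I' = I := by
    rw [hI', hI]
    exact integral_congr_ae (ae_of_all _ fun x => by
      show torusStrainSqAt (u t) x ^ (q / 2 - 1) * _ = ‖strainFlat (u t) x‖ ^ (q - 2) * _
      rw [strainSqAt_rpow_half_sub_one])
  rw [← hXN, ← hXP, ← hI', hII] at hle
  have hI0 : 0 ≤ I := by
    rw [hI]; exact integral_nonneg fun x => mul_nonneg (Real.rpow_nonneg (norm_nonneg _) _)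
      (Finset.sum_nonneg fun k _ => Finset.sum_nonneg fun i _ =>
        Finset.sum_nonneg fun j _ => sq_nonneg _)
  have hZ0 : 0 ≤ Z := by rw [hZ]; exact integral_nonneg fun x => Real.rpow_nonneg (norm_nonneg _) _
  have hF0 : 0 ≤ F := by rw [hFq]; exact integral_nonneg fun x => Real.rpow_nonneg (norm_nonneg _) _
  have hM0 : 0 ≤ M := by rw [hM]; exact mul_nonneg hZ0 (Real.rpow_nonneg hF0 _)
  have hsplit : (CT * I ^ 3) ^ (e / 3) = CT ^ (e / 3) * I ^ e := by
    rw [Real.mul_rpow hCT0 (pow_nonneg hI0 3), ← Real.rpow_natCast I 3, ← Real.rpow_mul hI0]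
    congr 2
    push_cast
    ring
  -- the static bounds `|X_N| ≤ CN I^e M^{1-e}`, `|X_P| ≤ CQ I^e M^{1-e}`
  have hstatN : |XN| ≤ CN * I ^ e * M ^ (1 - e) := by
    have h := nonlinear_production_rpow_le hK0 hq hCT hK hut hdiv
    rw [← hXN, ← hI, ← hZ, ← hFq, ← he, ← hM, hsplit] at h
    calc |XN| ≤ Real.sqrt 2 * K ^ (1 / q) * (CT ^ (e / 3) * I ^ e) * M ^ (1 - e) := h
      _ = CN * I ^ e * M ^ (1 - e) := by rw [hCN]; ring
  have hstatP : |XP| ≤ CQ * I ^ e * M ^ (1 - e) := by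
    have h := pressure_production_rpow_le hK0 hCP0 hq hCT hK hsol
      (fun s hs i j => hCP hab hsol s hs i j) ht
    rw [← hXP, ← hI, ← hZ, ← hFq, ← he, ← hM, hsplit] at h
    calc |XP| ≤ Real.sqrt 2 * ((9 : ℝ) ^ q * CP * K) ^ (1 / q) * (CT ^ (e / 3) * I ^ e) *
        M ^ (1 - e) := h
      _ = CQ * I ^ e * M ^ (1 - e) := by rw [hCQ]; ring
  have hstat : |XN| + |XP| ≤ (CN + CQ) * I ^ e * M ^ (1 - e) := by
    have h := add_le_add hstatN hstatP
    linarith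
  -- Young
  have hY := VorticityMoment.young_rpow he0 he1 hC0 hI0 hM0 hν
  -- the budget in closed form
  have hbudget : q / 2 * (CN + CQ) ^ (1 / (1 - e)) * ν ^ (-((3 * q - 3) / (2 * q - 3))) *
      (2 * torusEnstrophy (u t)) * (torusStrainMoment q (u t)) ^ (1 + (2 * q - 3)⁻¹) =
      q * ((CN + CQ) ^ (1 / (1 - e)) * ν ^ (-(e / (1 - e))) * M) := by
    have e1 : torusEnstrophy (u t) = Z := by rw [hZ]; exact torusEnstrophy_eq_integral_norm_sq hut hdiv
    have e2 : torusStrainMoment q (u t) = F := by rw [torusStrainMoment_eq_integral_norm, hFq]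
    rw [e1, e2, hγ, hM]
    ring
  rw [hbudget]
  have hXN' : -XN ≤ |XN| := neg_le_abs XN
  have hXP' : -XP ≤ |XP| := neg_le_abs XP
  have hq0 : 0 ≤ q := by linarith
  have hchain : -XN + -XP ≤ ν * I + (CN + CQ) ^ (1 / (1 - e)) * ν ^ (-(e / (1 - e))) * M :=
    ((add_le_add hXN' hXP').trans hstat).trans hY
  have h1 : -(q * ν * I) - q * XP - q * XN ≤
      q * ((CN + CQ) ^ (1 / (1 - e)) * ν ^ (-(e / (1 - e))) * M) := by
    have := mul_le_mul_of_nonneg_left hchain hq0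
    linarith
  exact hle.trans h1

/-! ## 3. The matrix row `q = 3` -/

/-- **Row `ES.absS.q=3|T_LD|G1` (kernel):** `∃ κ, SaturatingLaw (torusStrainMoment 3) 3 2 κ` on
`T³` — `d/dt ∫|S|³ ≤ κ ν^{−2} (2ℰ) (∫|S|³)^{4/3}`. [ours] -/
theorem strainMoment_saturatingLaw_three :
    ∃ κ : ℝ, SaturatingLaw (d := Fin 3) (torusStrainMoment 3) 3 2 κ := by
  obtain ⟨κ, hκ⟩ := strainMoment_saturatingLaw (q := 3) (by norm_num)
  have e1 : (2 : ℝ) * 3 - 3 = 3 := by norm_num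
  have e2 : ((3 : ℝ) * 3 - 3) / (2 * 3 - 3) = 2 := by norm_num
  rw [e2, e1] at hκ
  exact ⟨κ, hκ⟩

/-- **Row `ES.absS.q=5/2|T_LD|G1` (kernel):** `∃ κ, SaturatingLaw (torusStrainMoment (5/2)) 2 (9/4) κ`
on `T³`. [ours] -/
theorem strainMoment_saturatingLaw_five_halves :
    ∃ κ : ℝ, SaturatingLaw (d := Fin 3) (torusStrainMoment (5 / 2)) 2 (9 / 4) κ := by
  obtain ⟨κ, hκ⟩ := strainMoment_saturatingLaw (q := 5 / 2) (by norm_num)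
  have e1 : (2 : ℝ) * (5 / 2) - 3 = 2 := by norm_num
  have e2 : ((3 : ℝ) * (5 / 2) - 3) / (2 * (5 / 2) - 3) = 9 / 4 := by norm_num
  rw [e2, e1] at hκ
  exact ⟨κ, hκ⟩

/-! ## 4. The Lyapunov rows `EK.ES.absS.q|T_M0` -/

/-- **Rows `EK.ES.absS.q|T_M0` for real `q > 2` (kernel), on `T³`.** There is `κ > 0` such that
along every zero-mean classical solution of unforced Navier–Stokes on `T³ × [a, b]` with
`∫|S(u t)|^q > 0` on the window,
`t ↦ K(u t) − ((2q−3)/κ) ν^{(3q−3)/(2q−3)+1} (∫|S(u t)|^q)^{−1/(2q−3)}` is antitone —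
`strainMoment_saturatingLaw` (κ raised to `max κ 1`) and `SaturatingLaw.antitoneOn_lyapunov`.
[folklore] -/
theorem strainMoment_lyapunov_antitoneOn {q : ℝ} (hq : 2 < q) :
    ∃ κ : ℝ, 0 < κ ∧ ∀ {ν a b : ℝ}, 0 < ν → a < b →
      ∀ {u : ℝ → UnitAddTorus (Fin 3) → EuclideanSpace ℝ (Fin 3)}
        {p : ℝ → UnitAddTorus (Fin 3) → ℝ},
        Torus.IsClassicalNSSolutionOn (Icc a b) ν 0 u p →
        (∀ t ∈ Icc a b, Torus.HasZeroMean (u t)) →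
        (∀ t ∈ Icc a b, 0 < torusStrainMoment q (u t)) →
        AntitoneOn (fun t => Torus.kineticEnergy (u t) -
            (2 * q - 3) / κ * ν ^ ((3 * q - 3) / (2 * q - 3) + 1) *
              torusStrainMoment q (u t) ^ (-(2 * q - 3)⁻¹)) (Icc a b) := by
  obtain ⟨κ₀, hκ₀⟩ := strainMoment_saturatingLaw hq
  have hF0 : ∀ v : UnitAddTorus (Fin 3) → EuclideanSpace ℝ (Fin 3), 0 ≤ torusStrainMoment q v :=
    fun v => torusStrainMoment_nonneg q v
  have hlaw := hκ₀.mono_kappa hF0 (le_max_left κ₀ 1)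
  have hκ : 0 < max κ₀ 1 := lt_of_lt_of_le one_pos (le_max_right _ _)
  refine ⟨max κ₀ 1, hκ, fun hν hab u p hsol hmean hpos => ?_⟩
  exact hlaw.antitoneOn_lyapunov (by linarith) hκ (by simp) hν hab hsol hmean hpos

/-- **Row `EK.ES.absS.q=3|T_M0` (kernel):** `∃ κ > 0`, `K − (3/κ) ν³ (∫|S|³)^{−1/3}` antitone on
positive-`∫|S|³` windows of zero-mean classical solutions on `T³`. [ours] -/
theorem strainMoment_lyapunov_three :
    ∃ κ : ℝ, 0 < κ ∧ ∀ {ν a b : ℝ}, 0 < ν → a < b →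
      ∀ {u : ℝ → UnitAddTorus (Fin 3) → EuclideanSpace ℝ (Fin 3)}
        {p : ℝ → UnitAddTorus (Fin 3) → ℝ},
        Torus.IsClassicalNSSolutionOn (Icc a b) ν 0 u p →
        (∀ t ∈ Icc a b, Torus.HasZeroMean (u t)) →
        (∀ t ∈ Icc a b, 0 < torusStrainMoment 3 (u t)) →
        AntitoneOn (fun t => Torus.kineticEnergy (u t) -
            3 / κ * ν ^ (3 : ℝ) * torusStrainMoment 3 (u t) ^ (-(1 / 3 : ℝ))) (Icc a b) := by
  obtain ⟨κ, hκ, h⟩ := strainMoment_lyapunov_antitoneOn (q := 3) (by norm_num)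
  refine ⟨κ, hκ, fun hν hab u p hsol hmean hpos => ?_⟩
  have h' := h hν hab hsol hmean hpos
  refine h'.congr fun t _ => ?_
  norm_num

end StrainMoment

end Summit.NavierStokesRegularity.FunctionalMining
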